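import Summits.BirchSwinnertonDyer.BirchSwinnertonDyer.Theorems.CMKolyvaginAtInertTwoLevelZeroOneBitBSDTwoOfPrintedInputs
import Literature.NumberTheory.EllipticCurves.KrizLi2019.AssumptionStarTwoPrimitiveProofs
import HarnessLib

/-!
# Route `CMKolyvaginAtInertTwo` (leaf `WAllCornerFTwo`, habitat H₂): THE CONDUCTOR-FREE KRIZ–LI (★)-DOOR ON H₂ —
# `BSD₂(E)` for every `E ∈ H₂` whose Heegner point over a ONE-BIT Heegner field satisfies Kriz–Li's Assumption (★),
# modulo the route's printed inputs ONLY (GZ, GZK, modularity, Milne, Burungale–Flach, Gross 1991 Prop. 3.7 (2))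

Seat `bsd-line-cmk2-p1` g22 (cell `bsd-print-cf2`).  THEOREMS ONLY (no definition, no named fact, no `sorry`).  BSD is NOT
proved by this: CONDITIONAL class theorems (helper; a class aside is the pen's call).

WHAT.  g21's level-zero one-bit class theorem (`KolyvaginLowerTwo.bsdp_two_of_levelZero_of_sum_defect_le_one_of_printedInputs`,
p760958) concludes `BSDp W 2` on H₂ from a Heegner field `K` with `Σ ≤ 1`, an odd-Manin frame and a Heegner point `y_K = P(1)` of
infinite order that is `2`-INDIVISIBLE in `E(K[1])`.  Kriz–Li's Assumption (★) (FMS 2019 Thm. 1.12/§4: «`2` splits in `K` and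
`|Ẽ^{ns}(𝔽₂)|·log_{ω_E}(P)/2 ≢ 0 (mod 2)`», tree `KrizLi2019.AssumptionStar`) is a PRINTED, per-pair computable certificate of
exactly these two facts: by the first step of their Lemma 5.4 — now PROVED in the tree,
`KrizLi2019.not_exists_two_nsmul_add_torsion_of_assumptionStar` / `not_isOfFinAddOrder_of_assumptionStar` — (★) with `c₂(E)` and
the Manin constant odd forces `P ∉ 2E(K) + E(K)_tors` and `P` of infinite order; McCallum's Lemma 5.1 descent
(`X11b.Three.Koly.pDiv_one_iff_exists_zsmul_eq`, `E(K[1])[2^∞] = 0` on H₂ by `CMExactDescent.eq_zero_of_two_pow_smul_eq_zero_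
ringClassField`) moves this to `E(K[1])`.  Hence:

* **`bsdp_two_of_assumptionStar_of_sum_defect_le_one_of_printedInputs`** — `W ∈ H₂` (globally minimal, CM, `2` inert in the CM
  field, `ρ̄_{E,2}` onto, `r_an = 1`, odd Tamagawa product), `c₂(W)` odd; `K` imaginary quadratic with odd `d_K ≠ −3`, Heegner,
  `Σ ≤ 1`; an optimal parametrisation `Dt` with odd `Dt.c`; `β`, `ι`, a level-`1` datum `d₁`; a point `P₀ ∈ E(K)` under
  `P(1) = d₁.derivedPoint`; `j : K → ℚ₂` with `AssumptionStar W Dt K P₀ j` ⟹ `BSDp W 2`, modulo the six prints.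
* **`bsdp_two_of_exists_assumptionStar_oneBit_of_printedInputs`** — the bookable ∃-package: `W ∈ H₂` with odd `c₂` and SOME such
  `(K, Dt, β, ι, d₁, P₀, j)` ⟹ `BSDp W 2`.

WHY IT IS NEW (relative to the cell's booked (★)-door `PrintCf2.InertKrizLiStarDoorOfFactsPlus`, 21366): that aside needs a base
of conductor `< 5000` (Creutz–Miller / Miller–Stoll supply `BSD₂` of the base) and the Kriz–Li transport prints (Thm. 4.3 / 5.1);
Kriz–Li themselves take `BSD(2)` of the base as an INPUT (FMS Rem. 1.6: «the `p`-converse … for `p = 2` is not known»).  Here the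
base's `BSD₂` is DERIVED on H₂ — any conductor — from (★) alone, by the line's Kolyvagin machine at the inert prime `2` (the level-zero
`2`-converse) — so for `(★)`-pairs with a ONE-BIT field no Kriz–Li theorem is consumed at all, only their Assumption as a certificate
format.  Price: the H₂ hypotheses (odd Tamagawa product, optimal odd-Manin frame) and `Σ ≤ 1`.

HONEST FRAMING: conditional on SIX statement-only prints (GZ all levels, GZK, `exists_isNewformOf`, Milne any-model, Burungale–Flach,
Gross 3.7 (2)); (★) is a displayed hypothesis (per pair it is a finite `2`-adic computation, cell DOSSIER §14.8); no curve is shown to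
satisfy it here.  BSD is NOT proved by this; no summit statement and no item is closed by this file.

References: [KrizLi2019] FMS Thm. 1.12, §4 (★), Lemma 5.4, Rem. 1.6; [McCallumLMS1991] §5 Lemma 5.1, Thm. 5.4; [GrossLMS1991]
Prop. 3.7 (2); [GrossZagier1986] I.6.3, V.§2; [Milne1972ArithmeticAV] Thm. 1; [BurungaleFlach2024] Thm. 1.1, Cor. 2.
-/

set_option autoImplicit false
-- the Theorems namespace of this sub repeats the summit name by design (D-0017 nested layout)
set_option linter.dupNamespace false

noncomputable section

open scoped Classical

open WeierstrassCurve NumberField Literature.NumberTheory.EllipticCurves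
  Literature.NumberTheory.EllipticCurves.ModularForms
  Literature.NumberTheory.EllipticCurves.Rank1Residual
  Literature.NumberTheory.EllipticCurves.KrizLi2019
  Summit.BirchSwinnertonDyer.Rank1Residual
open Literature.NumberTheory.EllipticCurves.GrossLMS1991 (prop37_2_reductionCongruence_inert)
open Summit.BirchSwinnertonDyer.BirchSwinnertonDyer.Theorems.CMExactDescent

namespace Summit.BirchSwinnertonDyer.BirchSwinnertonDyer.Theorems.KolyvaginLowerTwo

/-! ## §1 (★) at the level-`1` frame: `y_K` has infinite order and is `2`-indivisible in `E(K[1])` -/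

/-- **(★) ⟹ the two certificate clauses of the level-zero class theorem.**  For `W/ℚ` globally minimal with `ρ̄_{E,2}` onto and
`c₂(W)` odd, `K` imaginary quadratic with odd `d_K`, Heegner, a datum `Dt` with odd `Dt.c`, a level-`1` Kolyvagin–Heegner datum
`d₁`, a point `P₀ ∈ E(K)` mapping to `P(1) = d₁.derivedPoint`, and `j : K → ℚ₂` with `AssumptionStar W Dt K P₀ j`:
`P(1)` has infinite order and is not `2`-divisible in `E(K[1])` (Kriz–Li Lemma 5.4 first step over `K`; McCallum Lemma 5.1 descent
along `E(K) ↪ E(K[1])`, no `2`-power torsion in `E(K[1])`). [cite: KrizLi2019, Lemma 5.4 (FMS), proof]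
[cite: McCallumLMS1991, §5 Lemma 5.1] -/
theorem not_isOfFinAddOrder_and_not_twoDivisible_of_assumptionStar
    (W : WeierstrassCurve ℚ) [W.IsElliptic] [W.IsGloballyMinimal] [NeZero (W.conductorNorm ℤ)]
    (hρ2 : W.HasSurjectiveModNGaloisRep 2)
    (hc2 : haveI : Fact (Nat.Prime 2) := ⟨Nat.prime_two⟩; Odd ((W.baseChange ℚ_[2]).localTamagawaNumber ℤ_[2]))
    (K : Type) [Field K] [NumberField K] (hIQ : IsImaginaryQuadratic K) (hodd : Odd (NumberField.discr K))
    (hHe : SatisfiesHeegnerHypothesis (W.conductorNorm ℤ) K)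
    (Dt : ModularParametrizationData W (W.conductorNorm ℤ)) (hc : Odd Dt.c) (β : ℤ) (ι : K →+* ℂ)
    (d₁ : KolyvaginHeegnerData Dt β ι 1) (P₀ : (W.baseChange K).toAffine.Point)
    (hP₀K : WeierstrassCurve.Affine.Point.map (W' := W) (algebraMap K (ringClassField K ι 1)).toRatAlgHom P₀ = d₁.derivedPoint)
    (j : K →ₐ[ℚ] ℚ_[2]) (hstar : AssumptionStar W Dt K P₀ j) :
    ¬ IsOfFinAddOrder d₁.derivedPoint ∧
      ¬ ∃ Q : (W.baseChange (ringClassField K ι 1)).toAffine.Point, (2 : ℤ) • Q = d₁.derivedPoint := by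
  refine ⟨fun hfin => ?_, fun ⟨Q, hQ⟩ => ?_⟩
  · apply not_isOfFinAddOrder_of_assumptionStar W Dt K P₀ j hstar hc2 hc
    rw [← hP₀K] at hfin
    exact (WeierstrassCurve.Affine.Point.map_injective (W' := W) _).isOfFinAddOrder_iff.mp hfin
  · have htor1 : ∀ R : (W.baseChange (ringClassField K ι 1)).toAffine.Point, ((2 ^ 1 : ℕ) : ℤ) • R = 0 → R = 0 :=
      fun R hR ↦ eq_zero_of_two_pow_smul_eq_zero_ringClassField W hIQ hodd hHe hρ2 ι 1 R hR
    have hdiv : X11b.Three.Koly.PDiv d₁ 2 1 := ⟨Q, by rw [pow_one, Nat.cast_ofNat]; exact hQ⟩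
    obtain ⟨Q₀, hQ₀⟩ := (X11b.Three.Koly.pDiv_one_iff_exists_zsmul_eq hIQ d₁ P₀ hP₀K 2 1 htor1).mp hdiv
    exact not_exists_two_zsmul_eq_of_assumptionStar W Dt K P₀ j hstar hc2 hc ⟨Q₀, by rw [← hQ₀, pow_one, Nat.cast_ofNat]⟩

/-! ## §2 The conductor-free (★)-door on H₂ -/

/-- **THE CONDUCTOR-FREE (★)-DOOR ON H₂.**  `W ∈ H₂` (globally minimal, CM, `2` inert in the CM field, `ρ̄_{E,2}` onto, `r_an(E) = 1`,
odd Tamagawa product) with `c₂(W)` odd; `K` imaginary quadratic, `d_K` odd `≠ −3`, Heegner for `N_E`, genus defect `Σ ≤ 1`; an optimal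
parametrisation `Dt` (lattice clause) of odd Manin constant; `β`, `ι`, `d₁`; `P₀ ∈ E(K)` under `P(1)`; `j : K → ℚ₂` with Kriz–Li's
Assumption (★) `AssumptionStar W Dt K P₀ j`.  THEN `BSDp W 2`, modulo GZ (all levels), GZK, modularity, Milne any-model,
Burungale–Flach and Gross 1991 Prop. 3.7 (2): (★) makes `y_K` non-torsion and `2`-indivisible (§1), and g21's level-zero one-bit
class theorem concludes.  No Kriz–Li THEOREM is used — only their Assumption as a certificate; no conductor bound.
[cite: KrizLi2019, Thm. 1.12 (FMS) and Lemma 5.4] [cite: McCallumLMS1991, §5 Thm. 5.4] [cite: GrossZagier1986, V.§2]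
[cite: BurungaleFlach2024, Thm. 1.1 and Cor. 2] [cite: GrossLMS1991, Prop. 3.7 (2)] -/
theorem bsdp_two_of_assumptionStar_of_sum_defect_le_one_of_printedInputs
    (hGZ : ∀ (N : ℕ) [NeZero N] (W : WeierstrassCurve ℚ) (K : Type) [Field K] [NumberField K], gross_zagier N W K)
    (hGZK : rank_eq_analyticRank_of_analyticRank_le_one) (hnf : exists_isNewformOf)
    (hMilneC : Milne1972.bsdQuotient_baseChange_quadratic_anyModel) (hBF : bsdTriple_of_hasCM_of_L_one_ne_zero)
    (W : WeierstrassCurve ℚ) [W.IsElliptic] [W.IsGloballyMinimal] [NeZero (W.conductorNorm ℤ)]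
    (hCM : W.HasCM) (hin : Rank1Residual.CMInert W 2) (hρ2 : W.HasSurjectiveModNGaloisRep 2) (hr : W.analyticRank = 1)
    (hT : Odd W.tamagawaProduct)
    (hc2 : haveI : Fact (Nat.Prime 2) := ⟨Nat.prime_two⟩; Odd ((W.baseChange ℚ_[2]).localTamagawaNumber ℤ_[2]))
    (K : Type) [Field K] [NumberField K] (hIQ : IsImaginaryQuadratic K)
    (hodd : Odd (NumberField.discr K)) (h3 : NumberField.discr K ≠ -3) (hHe : SatisfiesHeegnerHypothesis (W.conductorNorm ℤ) K)
    (hdef : ∑ q ∈ (NumberField.discr K).natAbs.primeFactors,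
        ((if jacobiSym W.Δ.num q = -1 then 1 else 0) +
          (if jacobiSym W.Δ.num q = 1 ∧ Even (W.frobeniusTrace q) then 2 else 0)) ≤ 1)
    (h37 : prop37_2_reductionCongruence_inert (W.conductorNorm ℤ) W K)
    (Dt : ModularParametrizationData W (W.conductorNorm ℤ))
    (hopt : ∀ z ∈ Dt.L.lattice, ∃ w ∈ periodLattice Dt.f, z = (Dt.c : ℂ) * w) (hc : Odd Dt.c)
    (β : ℤ) (ι : K →+* ℂ) (d₁ : KolyvaginHeegnerData Dt β ι 1) (P₀ : (W.baseChange K).toAffine.Point)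
    (hP₀K : WeierstrassCurve.Affine.Point.map (W' := W) (algebraMap K (ringClassField K ι 1)).toRatAlgHom P₀ = d₁.derivedPoint)
    (j : K →ₐ[ℚ] ℚ_[2]) (hstar : AssumptionStar W Dt K P₀ j) :
    BSDp W 2 := by
  obtain ⟨hy, hprim⟩ := not_isOfFinAddOrder_and_not_twoDivisible_of_assumptionStar W hρ2 hc2 K hIQ hodd hHe Dt hc β ι d₁ P₀
    hP₀K j hstar
  exact bsdp_two_of_levelZero_of_sum_defect_le_one_of_printedInputs hGZ hGZK hnf hMilneC hBF W hCM hin hρ2 hr hT K hIQ hodd h3 hHe hdef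
    h37 Dt hopt hc β ι d₁ hy hprim

/-- **The bookable ∃-package**: `W ∈ H₂` with `c₂(W)` odd and SOME one-bit Heegner field `K` (with Gross 3.7 (2) for `(W, K)`), SOME
optimal odd-Manin frame `(Dt, β, ι, d₁)`, SOME `P₀ ∈ E(K)` under `P(1)` and SOME `j : K → ℚ₂` with Assumption (★) ⟹ `BSDp W 2`, modulo
the five BSD-side prints.  (Per pair, (★) is a finite `2`-adic computation; cell DOSSIER §14.8 lists certified pairs.)  BSD is NOT proved
by this. [cite: KrizLi2019, Thm. 1.12 (FMS) and Lemma 5.4] [cite: McCallumLMS1991, §5 Thm. 5.4] [cite: BurungaleFlach2024, Thm. 1.1 and Cor. 2] -/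
theorem bsdp_two_of_exists_assumptionStar_oneBit_of_printedInputs
    (hGZ : ∀ (N : ℕ) [NeZero N] (W : WeierstrassCurve ℚ) (K : Type) [Field K] [NumberField K], gross_zagier N W K)
    (hGZK : rank_eq_analyticRank_of_analyticRank_le_one) (hnf : exists_isNewformOf)
    (hMilneC : Milne1972.bsdQuotient_baseChange_quadratic_anyModel) (hBF : bsdTriple_of_hasCM_of_L_one_ne_zero)
    (W : WeierstrassCurve ℚ) [W.IsElliptic] [W.IsGloballyMinimal] [NeZero (W.conductorNorm ℤ)]
    (hCM : W.HasCM) (hin : Rank1Residual.CMInert W 2) (hρ2 : W.HasSurjectiveModNGaloisRep 2) (hr : W.analyticRank = 1)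
    (hT : Odd W.tamagawaProduct)
    (hc2 : haveI : Fact (Nat.Prime 2) := ⟨Nat.prime_two⟩; Odd ((W.baseChange ℚ_[2]).localTamagawaNumber ℤ_[2]))
    (hpack : ∃ (K : Type) (_ : Field K) (_ : NumberField K), IsImaginaryQuadratic K ∧ Odd (NumberField.discr K) ∧
      NumberField.discr K ≠ -3 ∧ SatisfiesHeegnerHypothesis (W.conductorNorm ℤ) K ∧
      (∑ q ∈ (NumberField.discr K).natAbs.primeFactors,
        ((if jacobiSym W.Δ.num q = -1 then 1 else 0) +
          (if jacobiSym W.Δ.num q = 1 ∧ Even (W.frobeniusTrace q) then 2 else 0)) ≤ 1) ∧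
      prop37_2_reductionCongruence_inert (W.conductorNorm ℤ) W K ∧
      ∃ (Dt : ModularParametrizationData W (W.conductorNorm ℤ)) (β : ℤ) (ι : K →+* ℂ) (d₁ : KolyvaginHeegnerData Dt β ι 1)
        (P₀ : (W.baseChange K).toAffine.Point) (j : K →ₐ[ℚ] ℚ_[2]),
        (∀ z ∈ Dt.L.lattice, ∃ w ∈ periodLattice Dt.f, z = (Dt.c : ℂ) * w) ∧ Odd Dt.c ∧
        WeierstrassCurve.Affine.Point.map (W' := W) (algebraMap K (ringClassField K ι 1)).toRatAlgHom P₀ = d₁.derivedPoint ∧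
        AssumptionStar W Dt K P₀ j) :
    BSDp W 2 := by
  obtain ⟨K, _, _, hIQ, hodd, h3, hHe, hdef, h37, Dt, β, ι, d₁, P₀, j, hopt, hc, hP₀K, hstar⟩ := hpack
  exact bsdp_two_of_assumptionStar_of_sum_defect_le_one_of_printedInputs hGZ hGZK hnf hMilneC hBF W hCM hin hρ2 hr hT hc2 K hIQ hodd
    h3 hHe hdef h37 Dt hopt hc β ι d₁ P₀ hP₀K j hstar

/-! ## Append 1 (same seat): `c₂(W)` is odd on H₂ — the `hc2` binder discharged -/

/-- **`c₂(W)` is odd whenever the Tamagawa product is** (`c₂ ∣ ∏_v c_v`, tree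
`BoxerDiao2010.localTamagawaNumber_padic_dvd_tamagawaProduct`); on H₂ the product is odd by hypothesis.
[cite: SilvermanAEC2009, Cor. VII.6.2] -/
theorem odd_localTamagawaNumber_two_of_odd_tamagawaProduct (W : WeierstrassCurve ℚ) [W.IsElliptic]
    (hT : Odd W.tamagawaProduct) :
    haveI : Fact (Nat.Prime 2) := ⟨Nat.prime_two⟩
    Odd ((W.baseChange ℚ_[2]).localTamagawaNumber ℤ_[2]) :=
  haveI : Fact (Nat.Prime 2) := ⟨Nat.prime_two⟩
  hT.of_dvd_nat (BoxerDiao2010.localTamagawaNumber_padic_dvd_tamagawaProduct W 2)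

/-- **THE CONDUCTOR-FREE (★)-DOOR ON H₂, `c₂` clause removed** (it follows from the odd Tamagawa product of the habitat): `W ∈ H₂`; `K`
one-bit Heegner (odd `d_K ≠ −3`, `Σ ≤ 1`); optimal odd-Manin frame `(Dt, β, ι, d₁)`; `P₀ ∈ E(K)` under `P(1)`; `AssumptionStar W Dt K P₀ j`
⟹ `BSDp W 2`, modulo the six prints.  BSD is NOT proved by this. [cite: KrizLi2019, Thm. 1.12 (FMS) and Lemma 5.4]
[cite: McCallumLMS1991, §5 Thm. 5.4] [cite: BurungaleFlach2024, Thm. 1.1 and Cor. 2] [cite: GrossLMS1991, Prop. 3.7 (2)] -/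
theorem bsdp_two_of_assumptionStar_of_sum_defect_le_one_of_printedInputs'
    (hGZ : ∀ (N : ℕ) [NeZero N] (W : WeierstrassCurve ℚ) (K : Type) [Field K] [NumberField K], gross_zagier N W K)
    (hGZK : rank_eq_analyticRank_of_analyticRank_le_one) (hnf : exists_isNewformOf)
    (hMilneC : Milne1972.bsdQuotient_baseChange_quadratic_anyModel) (hBF : bsdTriple_of_hasCM_of_L_one_ne_zero)
    (W : WeierstrassCurve ℚ) [W.IsElliptic] [W.IsGloballyMinimal] [NeZero (W.conductorNorm ℤ)]
    (hCM : W.HasCM) (hin : Rank1Residual.CMInert W 2) (hρ2 : W.HasSurjectiveModNGaloisRep 2) (hr : W.analyticRank = 1)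
    (hT : Odd W.tamagawaProduct) (K : Type) [Field K] [NumberField K] (hIQ : IsImaginaryQuadratic K)
    (hodd : Odd (NumberField.discr K)) (h3 : NumberField.discr K ≠ -3) (hHe : SatisfiesHeegnerHypothesis (W.conductorNorm ℤ) K)
    (hdef : ∑ q ∈ (NumberField.discr K).natAbs.primeFactors,
        ((if jacobiSym W.Δ.num q = -1 then 1 else 0) +
          (if jacobiSym W.Δ.num q = 1 ∧ Even (W.frobeniusTrace q) then 2 else 0)) ≤ 1)
    (h37 : prop37_2_reductionCongruence_inert (W.conductorNorm ℤ) W K)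
    (Dt : ModularParametrizationData W (W.conductorNorm ℤ))
    (hopt : ∀ z ∈ Dt.L.lattice, ∃ w ∈ periodLattice Dt.f, z = (Dt.c : ℂ) * w) (hc : Odd Dt.c)
    (β : ℤ) (ι : K →+* ℂ) (d₁ : KolyvaginHeegnerData Dt β ι 1) (P₀ : (W.baseChange K).toAffine.Point)
    (hP₀K : WeierstrassCurve.Affine.Point.map (W' := W) (algebraMap K (ringClassField K ι 1)).toRatAlgHom P₀ = d₁.derivedPoint)
    (j : K →ₐ[ℚ] ℚ_[2]) (hstar : AssumptionStar W Dt K P₀ j) :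
    BSDp W 2 :=
  bsdp_two_of_assumptionStar_of_sum_defect_le_one_of_printedInputs hGZ hGZK hnf hMilneC hBF W hCM hin hρ2 hr hT
    (odd_localTamagawaNumber_two_of_odd_tamagawaProduct W hT) K hIQ hodd h3 hHe hdef h37 Dt hopt hc β ι d₁ P₀ hP₀K j hstar

/-- **The bookable ∃-package, `c₂` clause removed**: `W ∈ H₂` and SOME one-bit Heegner field `K` (with Gross 3.7 (2) for `(W, K)`), SOME
optimal odd-Manin frame `(Dt, β, ι, d₁)`, SOME `P₀ ∈ E(K)` under `P(1)` and SOME `j : K → ℚ₂` with Assumption (★) ⟹ `BSDp W 2`, modulo the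
five BSD-side prints.  BSD is NOT proved by this. [cite: KrizLi2019, Thm. 1.12 (FMS) and Lemma 5.4] [cite: McCallumLMS1991, §5 Thm. 5.4]
[cite: BurungaleFlach2024, Thm. 1.1 and Cor. 2] -/
theorem bsdp_two_of_exists_assumptionStar_oneBit_of_printedInputs'
    (hGZ : ∀ (N : ℕ) [NeZero N] (W : WeierstrassCurve ℚ) (K : Type) [Field K] [NumberField K], gross_zagier N W K)
    (hGZK : rank_eq_analyticRank_of_analyticRank_le_one) (hnf : exists_isNewformOf)
    (hMilneC : Milne1972.bsdQuotient_baseChange_quadratic_anyModel) (hBF : bsdTriple_of_hasCM_of_L_one_ne_zero)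
    (W : WeierstrassCurve ℚ) [W.IsElliptic] [W.IsGloballyMinimal] [NeZero (W.conductorNorm ℤ)]
    (hCM : W.HasCM) (hin : Rank1Residual.CMInert W 2) (hρ2 : W.HasSurjectiveModNGaloisRep 2) (hr : W.analyticRank = 1)
    (hT : Odd W.tamagawaProduct)
    (hpack : ∃ (K : Type) (_ : Field K) (_ : NumberField K), IsImaginaryQuadratic K ∧ Odd (NumberField.discr K) ∧
      NumberField.discr K ≠ -3 ∧ SatisfiesHeegnerHypothesis (W.conductorNorm ℤ) K ∧
      (∑ q ∈ (NumberField.discr K).natAbs.primeFactors,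
        ((if jacobiSym W.Δ.num q = -1 then 1 else 0) +
          (if jacobiSym W.Δ.num q = 1 ∧ Even (W.frobeniusTrace q) then 2 else 0)) ≤ 1) ∧
      prop37_2_reductionCongruence_inert (W.conductorNorm ℤ) W K ∧
      ∃ (Dt : ModularParametrizationData W (W.conductorNorm ℤ)) (β : ℤ) (ι : K →+* ℂ) (d₁ : KolyvaginHeegnerData Dt β ι 1)
        (P₀ : (W.baseChange K).toAffine.Point) (j : K →ₐ[ℚ] ℚ_[2]),
        (∀ z ∈ Dt.L.lattice, ∃ w ∈ periodLattice Dt.f, z = (Dt.c : ℂ) * w) ∧ Odd Dt.c ∧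
        WeierstrassCurve.Affine.Point.map (W' := W) (algebraMap K (ringClassField K ι 1)).toRatAlgHom P₀ = d₁.derivedPoint ∧
        AssumptionStar W Dt K P₀ j) :
    BSDp W 2 :=
  bsdp_two_of_exists_assumptionStar_oneBit_of_printedInputs hGZ hGZK hnf hMilneC hBF W hCM hin hρ2 hr hT
    (odd_localTamagawaNumber_two_of_odd_tamagawaProduct W hT) hpack

end Summit.BirchSwinnertonDyer.BirchSwinnertonDyer.Theorems.KolyvaginLowerTwo

end
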